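import Summits.HodgeConjecture.HodgeConjecture.Theses.LinearSystemTorelli
import Literature.AlgebraicGeometry.HodgeTheory.DivisorInduction
import Literature.AlgebraicGeometry.HodgeTheory.GysinKernelSplit
import Literature.AlgebraicGeometry.HodgeTheory.HypersurfaceLefschetz
import Literature.AlgebraicGeometry.HodgeTheory.TopDegreeClasses
import Literature.AlgebraicGeometry.HodgeTheory.LefschetzPencilHyperplaneSections

/-!
# Route LinearSystemTorelli — `DivisorInduction` (item stmt-HodgeConjecture-1082) from a LOCAL
# form of Deligne's Prop. 8.2.7: one covering family per support, one degree; and the Lefschetz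
# band `n + 2 ≤ 2p` where that local form is elementary

Helper file (prover seat c4, `--supports stmt-HodgeConjecture-1082`). The tree proves the item
modulo the named facts (A) `Deligne1974_ker_pullback_eq_ker_pullback_resolution` (Hodge III
Prop. 8.2.7 in Čech form, for EVERY finite family of morphisms from smooth projective varieties
and EVERY degree) and (B) the Hodge-class lift / polarizability
(`LinearSystemTorelliDivisorInductionLeaves`). The printed proof of the item, however, consumes
Prop. 8.2.7 only

* for ONE finite family of smooth projective `n`-folds `g j : Y j ⟶ X` whose joint image CONTAINS
  the support `Z` of the class (the prover of the item chooses the family), and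
* in the ONE degree `q = 2(n + 1) − 2p` complementary to the degree `2p` of the class,
* and only in the band `2 ≤ p ≤ n` (the slices `p = 1` and `p ≥ n + 1` are tautological /
  top-degree).

Results (all proved; no definitions, no named facts introduced):

* `mem_algebraicClasses_of_local_pullback_vanishing` — the `(n, p, X)`-pointwise statement: for a
  smooth projective `(n+1)`-fold `X` and `1 ≤ p ≤ n`, IF every Zariski-closed `Z ⊆ X` of
  codimension `≥ 1` is covered by a finite family of smooth projective `n`-folds over `X`
  satisfying Prop. 8.2.7 in degree `2(n+1) − 2p` (`hA'`), and (B) holds, and the Hodge conjecture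
  holds in codimension `p − 1` on smooth projective `n`-folds, THEN every rational `(p,p)`-class on
  `X` supported on a divisor is algebraic (the tree's `divisorInduction_of_deligne_of_hodgeClassLift`
  with the per-family Poincaré-duality transposition
  `ker_restrictCompl_le_iSup_range_complexGysin_of_pullback` in place of the global Cor. 8.2.8);
* `local_pullback_vanishing_of_deligne` — road (i): `hA'` from the named fact (A) with the padded
  resolutions of the components of `Z` (`exists_equidim_family_iUnion_range_eq`); nothing is lost:
  `linearSystemTorelli_divisorInduction_of_deligne_local` recovers the item modulo (A) + (B);
* `local_pullback_vanishing_of_hypersurfaceSection` — road (ii), ELEMENTARY: if `X` has a smooth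
  projective hypersurface section `H = X ∩ V₊(F)` of dimension `n` and `q ≤ n`, the family
  "padded resolutions of the components of `Z`, plus `H ↪ X`" satisfies Prop. 8.2.7 in degree `q`
  trivially, because a class killed by `H(ℂ)^*` in degree `q ≤ n` is zero (the Lefschetz
  hyperplane theorem, PROVED in the tree: `injective_complexBettiMap_hypersurfaceSection`,
  Andreotti–Frankel + duality); `q = 2(n+1) − 2p ≤ n` is the band `n + 2 ≤ 2p`;
* `exists_smooth_hypersurfaceSection_of_pencil` — smooth hyperplane sections from the tree's named
  fact `exists_fiberNet_pencil_hyperplaneSections` (Lefschetz pencils; the smooth base is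
  non-empty by the proved generic smoothness `FiberNet.smoothBase_nonempty_of_charZero`);
* `linearSystemTorelli_divisorInduction_of_lowBand_of_pencil` — ASSEMBLY: the route decl from
  (B), Lefschetz pencils, and the local Prop. 8.2.7 ONLY in the low band `2 ≤ p`, `2p ≤ n + 1`
  (which contains the middle degree `2p = n + 1` used by the route's Assembly). So the item's
  dependence on Deligne's mixed Hodge theory is confined to `4 ≤ 2p ≤ dim X`.
-/

noncomputable section

open CategoryTheory AlgebraicGeometry
open Literature.AlgebraicTopology.SingularHomology

namespace Summit.HodgeConjecture.HodgeConjecture.Theorems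

open Literature.AlgebraicGeometry.HodgeTheory Literature.AlgebraicGeometry.Motives

/-! ### The pointwise statement -/

/-- **Supported Hodge classes are algebraic, from a local Prop. 8.2.7 and the Hodge-class lift**
(pointwise in `n`, `p`, `X`). Let `X` be smooth projective of dimension `n + 1`, `p ≤ n`.
Hypothesis `hA'`: every Zariski-closed `Z ⊆ X` of codimension `≥ 1` lies in the joint image of a
finite family `g j : Y j ⟶ X` of morphisms from smooth projective `n`-folds such that, for
`2p + q = 2(n+1)`, every `x' ∈ Hᵠ(X(ℂ); ℂ)` killed by all `(g j)(ℂ)^*` vanishes on an open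
neighbourhood of `{P | pt P ∈ ⋃ j, g_j(Y j)}` (Deligne 1974, Prop. 8.2.7, for that family and
degree only). Hypothesis `hB`: Hodge classes in a sum of Gysin images lift to Hodge classes
(Voisin 2025, Cor. 2.12). Hypothesis `hHC`: rational `(p−1, p−1)`-classes on smooth projective
`n`-folds are algebraic. Then every rational `(p,p)`-class `c` on `X` supported on a divisor is
algebraic: `c` dies off a closed `Z` of codimension `≥ 1` (`exists_isClosed_of_mem_supportedClasses`),
hence off the joint image of the family (`complexBetti.restrictCompl_eq_zero_of_subset`); the
transposition `ker_restrictCompl_le_iSup_range_complexGysin_of_pullback` (Poincaré duality,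
proved) puts `c` in `Σ_j im (g j)_*`; `hB` rewrites it as `Σ_j (g j)_* b_j` with `b_j` rational
of type `(p−1, p−1)`, algebraic by `hHC`, and Gysin images of algebraic classes are algebraic
(`complexGysin_mem_algebraicClasses`). [cite: DeligneHodgeIII1974, Prop. 8.2.7 and Cor. 8.2.8]
[cite: Voisin2025, Cor. 2.12, Thm. 4.4 and Cor. 4.5 (i)] [cite: Thomas2005Nodes, §2] -/
theorem mem_algebraicClasses_of_local_pullback_vanishing {n p : ℕ} {X : SchemeOver ℂ}
    (hX : IsSmoothProjective (n + 1) X) (hpn : p ≤ n)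
    (hA' : ∀ ⦃Z : Set X.left⦄, IsClosed Z → (∀ z ∈ Z, (1 : ℕ∞) ≤ Order.coheight z) →
      ∀ ⦃q : ℕ⦄, 2 * p + q = 2 * (n + 1) →
      ∃ (ι : Type) (_ : Finite ι) (Y : ι → SchemeOver ℂ) (_ : ∀ j, IsSmoothProjective n (Y j))
        (g : ∀ j, Y j ⟶ X), Z ⊆ ⋃ j, Set.range (g j).left.base ∧
        ∀ x' : complexBetti X q, (∀ j, complexBetti.map (g j) q x' = 0) →
          ∃ V : Set (ComplexPoints X), IsOpen V ∧
            {P | P.pt ∈ ⋃ j, Set.range (g j).left.base} ⊆ V ∧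
            singularCohomology.map ℂ ℂ (subsetIncl V) q x' = 0)
    (hB : Voisin2025_hodgeClass_lift_complexGysin)
    (hHC : ∀ ⦃Y : SchemeOver ℂ⦄, IsSmoothProjective n Y →
      ∀ c : complexBetti Y (2 * (p - 1)), IsRationalClass c →
        IsOfHodgeType n Y (2 * (p - 1)) (p - 1) (p - 1) c → c ∈ algebraicClasses Y (p - 1))
    (c : complexBetti X (2 * p)) (hc : IsRationalClass c) (hc' : IsOfHodgeType (n + 1) X (2 * p) p p c)
    (hsupp : c ∈ supportedClasses X (2 * p) 1) : c ∈ algebraicClasses X p := by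
  classical
  let μ : OrientationFamily :=
    fun _ _ h ↦ Classical.choice (ComplexPoints.isOrientableOver ℂ h)
  have hμ : μ.HasPoincareDuality := μ.hasPoincareDuality
  -- `c` dies off one closed `Z` of codimension `≥ 1`
  obtain ⟨Z, hZ, hZ1, hcZ⟩ := exists_isClosed_of_mem_supportedClasses hsupp
  -- the family granted by `hA'`, in the complementary degree `q = 2(n+1) - 2p`
  obtain ⟨ι, hι, Y, hY, g, hZg, H⟩ := hA' hZ hZ1 (q := 2 * (n + 1) - 2 * p) (by omega)
  haveI := hι
  -- `c` dies off the (larger) joint image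
  have hcZ' : complexBetti.restrictCompl X (⋃ j, Set.range (g j).left.base) (2 * p) c = 0 :=
    complexBetti.restrictCompl_eq_zero_of_subset hZg hcZ
  -- Cor. 8.2.8 `⊆` for THIS family, by the Poincaré-duality transposition of `H`
  have hmem₀ : c ∈ ⨆ (j : ι) (a : ℕ) (hab : a + 2 * (n + 1) = 2 * p + 2 * n),
      LinearMap.range (complexGysin μ (hY j) hX (g j) hab) :=
    ker_restrictCompl_le_iSup_range_complexGysin_of_pullback μ hX hY g
      (b := 2 * p) (q := 2 * (n + 1) - 2 * p) (by omega) H (LinearMap.mem_ker.2 hcZ')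
  -- Cor. 2.12: Hodge classes in the Gysin image lift to Hodge classes
  have hmem := hB μ hμ hX hY g p hc hc' hmem₀
  refine SetLike.le_def.mp (iSup_le fun j ↦ iSup_le fun d ↦ iSup_le fun hd ↦ ?_) hmem
  rw [Submodule.map_le_iff_le_comap, Submodule.span_le]
  rintro b ⟨hb, hb'⟩
  rw [SetLike.mem_coe, Submodule.mem_comap]
  -- `d = p - 1`: the inductive hypothesis on the `n`-fold `Y j`, then push forward
  obtain rfl : d = p - 1 := by omega
  have halg : b ∈ algebraicClasses (Y j) (p - 1) := hHC (hY j) b hb hb'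
  exact complexGysin_mem_algebraicClasses (gysinMap_restrictCompl_eq_zero_of_field ℂ) μ hμ (hY j) hX
    (g j) (by omega) hd halg

/-! ### Road (i): the local hypothesis from the named fact (A) — nothing is lost -/

/-- **The local Prop. 8.2.7 from Deligne's global one.** The named fact
`Deligne1974_ker_pullback_eq_ker_pullback_resolution` (all families, all degrees) supplies `hA'`
of `mem_algebraicClasses_of_local_pullback_vanishing` with the padded resolutions of the
components of `Z` (`exists_equidim_family_iUnion_range_eq`: `Z = ⋃ j, g_j(Y j)` with `Y j`
smooth projective of dimension exactly `n`). [cite: DeligneHodgeIII1974, Prop. 8.2.7]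
[cite: BrosnanFangNiePearlstein2009, §6 Lemma 48 (proof)] -/
theorem local_pullback_vanishing_of_deligne
    (h827 : Deligne1974_ker_pullback_eq_ker_pullback_resolution)
    {n : ℕ} {X : SchemeOver ℂ} (hX : IsSmoothProjective (n + 1) X)
    {Z : Set X.left} (hZ : IsClosed Z) (hZ1 : ∀ z ∈ Z, (1 : ℕ∞) ≤ Order.coheight z) (q : ℕ) :
    ∃ (ι : Type) (_ : Finite ι) (Y : ι → SchemeOver ℂ) (_ : ∀ j, IsSmoothProjective n (Y j))
      (g : ∀ j, Y j ⟶ X), Z ⊆ ⋃ j, Set.range (g j).left.base ∧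
      ∀ x' : complexBetti X q, (∀ j, complexBetti.map (g j) q x' = 0) →
        ∃ V : Set (ComplexPoints X), IsOpen V ∧
          {P | P.pt ∈ ⋃ j, Set.range (g j).left.base} ⊆ V ∧
          singularCohomology.map ℂ ℂ (subsetIncl V) q x' = 0 := by
  obtain ⟨ι, hι, Y, hY, g, hZg⟩ := exists_equidim_family_iUnion_range_eq hX hZ hZ1
  haveI := hι
  exact ⟨ι, hι, Y, hY, g, hZg.symm.subset, fun x' hx' ↦ h827 hX hY g q x' hx'⟩

/-- **The item modulo (A) and (B), recovered through the local form** (same two inputs as the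
tree's `divisorInduction_of_deligne_of_hodgeClassLift`, Cor. 8.2.8 being entered at Prop. 8.2.7;
the edge slices `p = 1` — definitional — and `p ≥ n + 1` — `mem_algebraicClasses_of_degree_top`,
`algebraicClasses_eq_top_of_lt` — need nothing). [cite: DeligneHodgeIII1974, Prop. 8.2.7 and Cor. 8.2.8]
[cite: Voisin2025, Cor. 2.12] -/
theorem linearSystemTorelli_divisorInduction_of_deligne_local
    (h827 : Deligne1974_ker_pullback_eq_ker_pullback_resolution)
    (hB : Voisin2025_hodgeClass_lift_complexGysin) :
    Summit.HodgeConjecture.HodgeConjecture.Theses.LinearSystemTorelli.DivisorInduction := by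
  unfold Summit.HodgeConjecture.HodgeConjecture.Theses.LinearSystemTorelli.DivisorInduction
  intro n p hp hHC X hX c hc hc' hsupp
  rcases Nat.lt_or_ge n p with hnp | hpn
  · rcases (Nat.succ_le_of_lt hnp).eq_or_lt with h | hlt
    · subst h
      exact mem_algebraicClasses_of_degree_top hX (Nat.succ_le_succ (Nat.zero_le n)) c
    · rw [algebraicClasses_eq_top_of_lt hX hlt]
      exact Submodule.mem_top
  exact mem_algebraicClasses_of_local_pullback_vanishing hX hpn
    (fun Z hZ hZ1 q _ ↦ local_pullback_vanishing_of_deligne h827 hX hZ hZ1 q) hB hHC c hc hc' hsupp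

/-! ### Road (ii): the Lefschetz band `n + 2 ≤ 2p` — Prop. 8.2.7 is elementary there -/

/-- **Prop. 8.2.7 is free below the Lefschetz degree for a family containing a smooth hypersurface
section.** Let `X` be smooth projective of dimension `n + 1` with a projective embedding `e` and a
form `F` of degree `d ≥ 1` whose section `H = X ∩ V₊(F)` is smooth projective of dimension `n`, and
let `q ≤ n`. For every Zariski-closed `Z ⊆ X` of codimension `≥ 1`, the family "padded
resolutions of the components of `Z` (`exists_equidim_family_iUnion_range_eq`), plus `H ↪ X`"
consists of smooth projective `n`-folds, covers `Z`, and satisfies Prop. 8.2.7 in degree `q`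
TRIVIALLY: a class killed by `H(ℂ)^*` in degree `q ≤ n` is zero, by the Lefschetz hyperplane
theorem (Voisin II Thm. 1.23, PROVED in the tree: `injective_complexBettiMap_hypersurfaceSection`).
[cite: VoisinHodgeII2003, §1.2.2 Thm. 1.23] [cite: DeligneHodgeIII1974, Prop. 8.2.7] -/
theorem local_pullback_vanishing_of_hypersurfaceSection
    {n : ℕ} {X : SchemeOver ℂ} (hX : IsSmoothProjective (n + 1) X)
    (e : ProjectiveEmbedding X) {d : ℕ} (hd : 1 ≤ d) (F : MvPolynomial (Fin (e.n + 1)) ℂ)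
    (hF : F.IsHomogeneous d) (hH : IsSmoothProjective n (e.hypersurfaceSection F hF))
    {Z : Set X.left} (hZ : IsClosed Z) (hZ1 : ∀ z ∈ Z, (1 : ℕ∞) ≤ Order.coheight z)
    {q : ℕ} (hq : q ≤ n) :
    ∃ (ι : Type) (_ : Finite ι) (Y : ι → SchemeOver ℂ) (_ : ∀ j, IsSmoothProjective n (Y j))
      (g : ∀ j, Y j ⟶ X), Z ⊆ ⋃ j, Set.range (g j).left.base ∧
      ∀ x' : complexBetti X q, (∀ j, complexBetti.map (g j) q x' = 0) →
        ∃ V : Set (ComplexPoints X), IsOpen V ∧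
          {P | P.pt ∈ ⋃ j, Set.range (g j).left.base} ⊆ V ∧
          singularCohomology.map ℂ ℂ (subsetIncl V) q x' = 0 := by
  obtain ⟨ι, hι, Y, hY, g, hZg⟩ := exists_equidim_family_iUnion_range_eq hX hZ hZ1
  haveI := hι
  refine ⟨Option ι, inferInstance, fun o ↦ o.elim (e.hypersurfaceSection F hF) Y,
    fun o ↦ ?_, fun o ↦ match o with
      | none => e.hypersurfaceSectionι F hF
      | some j => g j, fun z hz ↦ ?_, fun x' hx' ↦ ?_⟩
  · cases o with
    | none => exact hH
    | some j => exact hY j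
  · -- `Z = ⋃ j, g_j(Y j)` sits inside the larger union
    rw [← hZg] at hz
    obtain ⟨j, hj⟩ := Set.mem_iUnion.1 hz
    exact Set.mem_iUnion.2 ⟨some j, hj⟩
  · -- weak Lefschetz: `x'|_H = 0` with `q ≤ n` forces `x' = 0`
    have h0 : x' = 0 :=
      injective_complexBettiMap_hypersurfaceSection hX e hd F hF hH hq
        (by rw [map_zero]; exact hx' none)
    exact ⟨Set.univ, isOpen_univ, Set.subset_univ _, by rw [h0, map_zero]⟩

/-- **Smooth hyperplane sections exist** (from the tree's named fact
`exists_fiberNet_pencil_hyperplaneSections`: a Lefschetz pencil of hyperplane sections of the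
smooth projective `(n+1)`-fold `X`, `n ≥ 1`, whose fibres over the smooth base are isomorphic over
`X` to hyperplane sections `X ∩ V₊(F)`; the smooth base is non-empty in characteristic `0`,
`FiberNet.smoothBase_nonempty_of_charZero`, and contains a complex point,
`ComplexPoints.exists_pt_mem`). Output: a projective embedding `e` of `X` and a linear form `F`
with `X ∩ V₊(F)` smooth projective of dimension `n`. [cite: VoisinHodgeII2003, §2.1.1]
[cite: Hartshorne1977, II Thm. 8.18 and III Cor. 10.7] -/
theorem exists_smooth_hypersurfaceSection_of_pencil (hpen : exists_fiberNet_pencil_hyperplaneSections)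
    {n : ℕ} (hn : 1 ≤ n) {X : SchemeOver ℂ} (hX : IsSmoothProjective (n + 1) X) :
    ∃ (e : ProjectiveEmbedding X) (F : MvPolynomial (Fin (e.n + 1)) ℂ) (hF : F.IsHomogeneous 1),
      IsSmoothProjective n (e.hypersurfaceSection F hF) := by
  have hX' : IsSmoothProjective (1 + n) X := Nat.add_comm n 1 ▸ hX
  obtain ⟨N, hN⟩ := hpen n hX.isProjectiveOver.projectiveEmbedding hn hX'
  haveI : IsProper (projectiveSpace 1 ℂ).hom :=
    IsSmoothProjective.isProper_holds (isSmoothProjective_projectiveSpace_holds ℂ 1)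
  obtain ⟨t, ht⟩ := ComplexPoints.exists_pt_mem (X := projectiveSpace 1 ℂ)
    N.smoothBase_nonempty_of_charZero N.smoothBase.isOpen.isLocallyClosed
  obtain ⟨F, hF, i, -⟩ := hN t
  exact ⟨_, F, hF, (N.isSmoothProjective_fiber_of_mem_smoothBase t ht).of_iso i⟩

/-! ### Assembly: the item from (B), Lefschetz pencils, and the local Prop. 8.2.7 in the low band -/

/-- **`DivisorInduction` with Deligne's Prop. 8.2.7 confined to the low band `4 ≤ 2p ≤ n + 1`.**
The route decl follows from: (B) the Hodge-class lift `Voisin2025_hodgeClass_lift_complexGysin`;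
Lefschetz pencils of hyperplane sections (`exists_fiberNet_pencil_hyperplaneSections`, for the
smooth hyperplane section used in the band `n + 2 ≤ 2p`); and the LOCAL Prop. 8.2.7 `hlow` only for
`2 ≤ p`, `2p ≤ n + 1`, `X` of dimension `n + 1`, closed `Z ⊆ X` of codimension `≥ 1` and the single
degree `q = 2(n+1) − 2p` (some covering family of smooth projective `n`-folds). Slices: `p = 1`
definitional; `p ≥ n + 1` top degree / vanishing; `n + 2 ≤ 2p ≤ 2n` road (ii)
(`local_pullback_vanishing_of_hypersurfaceSection`); `4 ≤ 2p ≤ n + 1` by `hlow`.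
[cite: DeligneHodgeIII1974, Prop. 8.2.7] [cite: VoisinHodgeII2003, §1.2.2 Thm. 1.23]
[cite: Voisin2025, Cor. 2.12] -/
theorem linearSystemTorelli_divisorInduction_of_lowBand_of_pencil
    (hlow : ∀ ⦃n p q : ℕ⦄ ⦃X : SchemeOver ℂ⦄, 2 ≤ p → 2 * p ≤ n + 1 → 2 * p + q = 2 * (n + 1) →
      IsSmoothProjective (n + 1) X →
      ∀ ⦃Z : Set X.left⦄, IsClosed Z → (∀ z ∈ Z, (1 : ℕ∞) ≤ Order.coheight z) →
      ∃ (ι : Type) (_ : Finite ι) (Y : ι → SchemeOver ℂ) (_ : ∀ j, IsSmoothProjective n (Y j))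
        (g : ∀ j, Y j ⟶ X), Z ⊆ ⋃ j, Set.range (g j).left.base ∧
        ∀ x' : complexBetti X q, (∀ j, complexBetti.map (g j) q x' = 0) →
          ∃ V : Set (ComplexPoints X), IsOpen V ∧
            {P | P.pt ∈ ⋃ j, Set.range (g j).left.base} ⊆ V ∧
            singularCohomology.map ℂ ℂ (subsetIncl V) q x' = 0)
    (hpen : exists_fiberNet_pencil_hyperplaneSections)
    (hB : Voisin2025_hodgeClass_lift_complexGysin) :
    Summit.HodgeConjecture.HodgeConjecture.Theses.LinearSystemTorelli.DivisorInduction := by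
  unfold Summit.HodgeConjecture.HodgeConjecture.Theses.LinearSystemTorelli.DivisorInduction
  intro n p hp hHC X hX c hc hc' hsupp
  rcases Nat.lt_or_ge n p with hnp | hpn
  · rcases (Nat.succ_le_of_lt hnp).eq_or_lt with h | hlt
    · subst h
      exact mem_algebraicClasses_of_degree_top hX (Nat.succ_le_succ (Nat.zero_le n)) c
    · rw [algebraicClasses_eq_top_of_lt hX hlt]
      exact Submodule.mem_top
  rcases hp.eq_or_lt with h | h2
  · subst h
    exact hsupp
  refine mem_algebraicClasses_of_local_pullback_vanishing hX hpn (fun Z hZ hZ1 q hq ↦ ?_) hB hHC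
    c hc hc' hsupp
  by_cases hband : 2 * p ≤ n + 1
  · exact hlow h2 hband hq hX hZ hZ1
  · -- the Lefschetz band `n + 2 ≤ 2p`: a smooth hyperplane section makes Prop. 8.2.7 trivial
    obtain ⟨e, F, hF, hH⟩ := exists_smooth_hypersurfaceSection_of_pencil hpen (by omega) hX
    exact local_pullback_vanishing_of_hypersurfaceSection hX e le_rfl F hF hH hZ hZ1 (by omega)

end Summit.HodgeConjecture.HodgeConjecture.Theorems

end
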